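import Summits.BirchSwinnertonDyer.BirchSwinnertonDyer.Theorems.SoloInformedTameDepth
import Literature.NumberTheory.EllipticCurves.KuriharaNumberKimStructure
import HarnessLib

/-!
# Tame depth, III: divisibility form, the elliptic curve, and the Selmer corank

Summit `BirchSwinnertonDyer`, solo-informed study, kernel file no. 18c (attempt A74, claim C62);
corollaries of `solo_twistedDepthPolynomial_coeff` (`SoloInformedTameDepth`: statement, meaning,
proof sketch). All proved; Kim's structure theorem enters only as the tree's hypothesis-`Prop`
`Kim2022_selmerCorank_le_of_kuriharaNumber_ne_zero`.

* `solo_X_pow_dvd_twistedDepthPolynomial`: `X² ∣ T(X)` always and `X³ ∣ T(X) ↔ δ_n = 0` — in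
  cyclotomic terms the order-`p` twisted value `S = ∑_a [a/n]⁺ ζ_p^{Ψ(a)} = χ(θ̃_n)` lies in
  `(ζ_p - 1)² ℤ_{(p)}[ζ_p]`, and (for `p ≥ 5`) has `π`-adic valuation exactly `2` iff `p ∤ δ_n`.
* `solo_twistedDepthPolynomial_coeff_of_isNewformOf`: the theorem for an elliptic curve `E = W/ℚ`
  with newform `f` (`IsNewformOf W f`): `p` odd with `E[p]` irreducible (which makes every
  `[a/n]⁺`, `gcd(n, N) = 1`, `p`-integral: `IsNewformOf.not_dvd_den_ratPlusSymbol_div`),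
  `ℓ₁ ≠ ℓ₂` good primes with `gcd(ℓ₁ℓ₂, N) = 1` and `a_{ℓᵢ}(E) ≡ 2 (mod p)` — the congruence half
  of "Kolyvagin prime" (`ℓ ≡ 1`, `a_ℓ ≡ ℓ + 1 (mod p)`; `Kato.IsKolyvaginPrime`).
* `solo_selmerCorank_le_two_of_not_cube_dvd`: in the setting of Kim's theorem (`p ≥ 5` good
  ordinary, `ρ̄_{E,p}` surjective, period transfer `Ω_E = u Ω⁺_f` with `u ∈ ℤ_{(p)}ˣ`,
  `n = ℓ₁ℓ₂` a Kolyvagin product of level `1`, `ψ_ℓ` surjective), **`X³ ∤ T(X)` implies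
  `corank_{ℤ_p} Sel_{p^∞}(E/ℚ) ≤ 2`**: the minimal `π`-adic depth of ONE order-`p` twisted
  `L`-value `L(E, χ, 1)`, `χ = ζ_p^Ψ` of conductor `ℓ₁ℓ₂`, bounds the Selmer corank by `2`
  (Kim's `δ_n ≢ 0 ⟹ corank ≤ ν(n)` read through `coeff₂ T = δ_n`).

Sources: [cite: Kim2022StructureSelmer, Thm. 1.9 (PDF p. 7) and §1.4];
[cite: Kurihara2014, §1.1 (PDF p. 2)]; [cite: MazurTate1987, §1].
-/

open scoped MatrixGroups ModularForm
open CongruenceSubgroup Polynomial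
open Literature.NumberTheory.EllipticCurves Literature.NumberTheory.EllipticCurves.ModularForms

namespace Summit.BirchSwinnertonDyer.BirchSwinnertonDyer.Theorems

section CuspForm

variable {N : ℕ} (f : CuspForm (Gamma0 N) 2) (p : ℕ) [hp : Fact p.Prime]

/-- **Divisibility form**: `X² ∣ T(X)` always, and `X³ ∣ T(X) ↔ δ_n = 0`. In cyclotomic terms
(`X ↦ ζ_p - 1`): the order-`p` twisted value `S = ∑_a [a/n]⁺ ζ_p^{Ψ(a)}` always lies in
`(ζ_p - 1)² ℤ_{(p)}[ζ_p]` (any odd `p`), and for `p ≥ 5` (so that `X³ ∣ X^{p-1}` and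
`p ℤ_{(p)}[ζ_p] = (ζ_p - 1)^{p-1} ℤ_{(p)}[ζ_p] ⊆ (ζ_p - 1)³ ℤ_{(p)}[ζ_p]`) it lies in
`(ζ_p - 1)³ ℤ_{(p)}[ζ_p]` iff `p ∣ δ_n`, i.e. `v_π(S) ≥ 3 ↔ p ∣ δ_n`. (At `p = 3` the
cyclotomic translation is vacuous — `(ζ_3 - 1)³ ℤ_{(3)}[ζ_3] + 3 ℤ_{(3)}[ζ_3] = (ζ_3 - 1)²
ℤ_{(3)}[ζ_3]` always contains `S` — while the polynomial statement `X³ ∣ T ↔ δ_n = 0` below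
holds for every odd `p`.) [folklore] -/
theorem solo_X_pow_dvd_twistedDepthPolynomial [NeZero N] (hf : IsNewform0 f)
    (hQ : coeffField f = ⊥) (hp2 : p ≠ 2) {ℓ₁ ℓ₂ n : ℕ} [Fact ℓ₁.Prime] [Fact ℓ₂.Prime]
    [NeZero n] (hn : n = ℓ₁ * ℓ₂) (hne : ℓ₁ ≠ ℓ₂) (hℓ₁N : ¬ ℓ₁ ∣ N) (hℓ₂N : ¬ ℓ₂ ∣ N)
    {a₁ a₂ : ℤ} (ha₁ : cuspCoeff f ℓ₁ = a₁) (ha₂ : cuspCoeff f ℓ₂ = a₂)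
    (ha₁p : (a₁ : ZMod p) = 2) (ha₂p : (a₂ : ZMod p) = 2)
    (hint : ∀ a : ℤ, ¬ p ∣ (ratPlusSymbol f ((a : ℚ) / n)).den)
    (ψ : (ℓ : ℕ) → (ZMod ℓ)ˣ →* Multiplicative (ZMod p)) :
    X ^ 2 ∣ soloTwistedDepthPolynomial f p n ψ ∧
      (X ^ 3 ∣ soloTwistedDepthPolynomial f p n ψ ↔ kuriharaNumber f p n ψ = 0) := by
  obtain ⟨h0, h1, h2⟩ := solo_twistedDepthPolynomial_coeff f p hf hQ hp2 hn hne hℓ₁N hℓ₂N ha₁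
    ha₂ ha₁p ha₂p hint ψ
  refine ⟨?_, ?_, ?_⟩
  · rw [Polynomial.X_pow_dvd_iff]
    intro d hd
    interval_cases d
    · exact h0
    · exact h1
  · intro h
    rw [Polynomial.X_pow_dvd_iff] at h
    rw [← h2]; exact h 2 (by norm_num)
  · intro h
    rw [Polynomial.X_pow_dvd_iff]
    intro d hd
    interval_cases d
    · exact h0
    · exact h1
    · rw [h2, h]

end CuspForm

section EllipticCurve

variable {N : ℕ} [NeZero N] (f : CuspForm (Gamma0 N) 2) (p : ℕ) [hp : Fact p.Prime]
  {W : WeierstrassCurve ℚ} [W.IsElliptic] [W.IsGloballyMinimal]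

/-- **Tame depth for an elliptic curve** `E = W / ℚ` with newform `f` (`IsNewformOf W f`), `p` odd
with `E[p]` irreducible (so that all `[a/n]⁺` with `gcd(n, N) = 1` are `p`-integral,
`IsNewformOf.not_dvd_den_ratPlusSymbol_div`), and two distinct good primes `ℓ₁, ℓ₂ ∤ N` with
`a_{ℓᵢ}(E) ≡ 2 (mod p)` — e.g. a Kolyvagin pair (`ℓᵢ ≡ 1`, `a_{ℓᵢ} ≡ ℓᵢ + 1 (mod p)`,
`Kato.isKolyvaginPrime_one_iff`): `coeff₀ T = coeff₁ T = 0` and `coeff₂ T = δ_{ℓ₁ℓ₂}`.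
[folklore] -/
theorem solo_twistedDepthPolynomial_coeff_of_isNewformOf (hfW : IsNewformOf W f) (hp2 : p ≠ 2)
    (hirr : W.HasIrreducibleModPGaloisRep p) {ℓ₁ ℓ₂ n : ℕ} [hℓ₁ : Fact ℓ₁.Prime]
    [hℓ₂ : Fact ℓ₂.Prime] [NeZero n] (hn : n = ℓ₁ * ℓ₂) (hne : ℓ₁ ≠ ℓ₂)
    (hnN : Nat.Coprime n N) (hgood₁ : W.HasGoodReductionAtPrime ℓ₁)
    (hgood₂ : W.HasGoodReductionAtPrime ℓ₂) (ha₁ : (W.frobeniusTrace ℓ₁ : ZMod p) = 2)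
    (ha₂ : (W.frobeniusTrace ℓ₂ : ZMod p) = 2)
    (ψ : (ℓ : ℕ) → (ZMod ℓ)ˣ →* Multiplicative (ZMod p)) :
    (soloTwistedDepthPolynomial f p n ψ).coeff 0 = 0 ∧
      (soloTwistedDepthPolynomial f p n ψ).coeff 1 = 0 ∧
      (soloTwistedDepthPolynomial f p n ψ).coeff 2 = kuriharaNumber f p n ψ := by
  have hℓ₁N : ¬ ℓ₁ ∣ N := (Nat.Prime.coprime_iff_not_dvd hℓ₁.out).mp
    (Nat.Coprime.coprime_dvd_left ⟨ℓ₂, hn⟩ hnN)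
  have hℓ₂N : ¬ ℓ₂ ∣ N := (Nat.Prime.coprime_iff_not_dvd hℓ₂.out).mp
    (Nat.Coprime.coprime_dvd_left ⟨ℓ₁, by rw [hn, mul_comm]⟩ hnN)
  exact solo_twistedDepthPolynomial_coeff f p hfW.1 hfW.coeffField_eq_bot hp2 hn hne hℓ₁N hℓ₂N
    (cuspCoeff_eq_frobeniusTrace_of_isNewformOf_holds hfW hgood₁)
    (cuspCoeff_eq_frobeniusTrace_of_isNewformOf_holds hfW hgood₂) ha₁ ha₂
    (fun a => hfW.not_dvd_den_ratPlusSymbol_div hp2 hirr hnN a) ψ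

/-- **Reading the Selmer corank off the depth** (with Kim's structure theorem as hypothesis): in
Kim's setting (`p ≥ 5` good ordinary, `ρ̄` surjective, period transfer, `n = ℓ₁ ℓ₂` a Kolyvagin
product of level `1`, `ψ_ℓ` surjective), if `X³ ∤ T(X)` — i.e. the order-`p` twisted value at the
pair has the minimal `π`-adic depth `2` — then `corank_{ℤ_p} Sel_{p^∞}(E/ℚ) ≤ 2`.
[cite: Kim2022StructureSelmer, Thm. 1.9 (PDF p. 7)] -/
theorem solo_selmerCorank_le_two_of_not_cube_dvd
    (hKim : Kim2022_selmerCorank_le_of_kuriharaNumber_ne_zero) (hfW : IsNewformOf W f)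
    (hp5 : 5 ≤ p) (hgood : W.HasGoodReductionAtPrime p) (hord : ¬ (p : ℤ) ∣ W.frobeniusTrace p)
    (hsurj : W.HasSurjectiveModNGaloisRep p)
    (hΩ : ∃ u : ℚ, ‖(u : ℚ_[p])‖ = 1 ∧ W.realPeriodRat = u * plusPeriod f)
    {ℓ₁ ℓ₂ n : ℕ} [hℓ₁ : Fact ℓ₁.Prime] [hℓ₂ : Fact ℓ₂.Prime] [NeZero n] (hn : n = ℓ₁ * ℓ₂)
    (hne : ℓ₁ ≠ ℓ₂) (hnN : Nat.Coprime n N) (hgood₁ : W.HasGoodReductionAtPrime ℓ₁)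
    (hgood₂ : W.HasGoodReductionAtPrime ℓ₂) (ha₁ : (W.frobeniusTrace ℓ₁ : ZMod p) = 2)
    (ha₂ : (W.frobeniusTrace ℓ₂ : ZMod p) = 2) (hKoly : Kato.IsKolyvaginProduct W p 1 n)
    (ψ : (ℓ : ℕ) → (ZMod ℓ)ˣ →* Multiplicative (ZMod p))
    (hψ : ∀ ℓ ∈ n.primeFactors, Function.Surjective (ψ ℓ))
    (hT : ¬ X ^ 3 ∣ soloTwistedDepthPolynomial f p n ψ) :
    W.selmerCorank p ≤ 2 := by
  haveI : NeZero p := ⟨hp.out.ne_zero⟩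
  have hp2 : p ≠ 2 := by omega
  have hirr : W.HasIrreducibleModPGaloisRep p :=
    hasIrreducibleModPGaloisRep_of_hasSurjectiveModNGaloisRep W p hsurj
  obtain ⟨h0, h1, h2⟩ := solo_twistedDepthPolynomial_coeff_of_isNewformOf f p hfW hp2 hirr hn hne
    hnN hgood₁ hgood₂ ha₁ ha₂ ψ
  have hδ : kuriharaNumber f p n ψ ≠ 0 := by
    intro hzero
    apply hT
    rw [Polynomial.X_pow_dvd_iff]
    intro d hd
    interval_cases d
    · exact h0
    · exact h1
    · rw [h2, hzero]
  have hK := hKim W p hp5 hgood hord hsurj f hfW hΩ 1 n le_rfl hKoly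
  rw [pow_one] at hK
  have hcard : n.primeFactors.card = 2 := by
    rw [hn, Nat.primeFactors_mul hℓ₁.out.ne_zero hℓ₂.out.ne_zero, hℓ₁.out.primeFactors,
      hℓ₂.out.primeFactors, ← Finset.insert_eq, Finset.card_pair hne]
  exact (hK ψ hψ hδ).trans hcard.le

end EllipticCurve

end Summit.BirchSwinnertonDyer.BirchSwinnertonDyer.Theorems
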